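import Summits.BirchSwinnertonDyer.BirchSwinnertonDyer.Theorems.PrintCFramBottomClassIndexLawFiveLeFlipRungTransport
import HarnessLib

set_option autoImplicit false

/-!
# Crux `PrintCFram.BottomClassIndexLawFiveLe` (stmt-BirchSwinnertonDyer-20372), line `eisenstein-resource-bdp-line` (registry v27,
# `stub_flipRung`): T4 file 2/2 — THE READING SOCKET at the flipped cusp: «a coefficient of `qExpansion N (V ∣_k ω₀)` equals
# unit · x · c, `x ∈ ℚ`, `p ∤ c` ⟹ `‖x‖_p ≤ p⁻¹`», from NF-Q
# (cell `bsd-print-cfram`, width seat `bsd-line-cfram-p1-w3` g19; THEOREMS ONLY, `--supports` 20372; BSD is not proved by any of this)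

HONEST FRAMING. Nothing here is a statement about elliptic curves or BSD; no registered stub is closed. Sequel to `…FlipRungTransport`
(T4 file 1/2: NF-Q at every coefficient of every cusp, §3; the linear integrality transfer, §5). This file is the SOCKET between seat
w4 g19's T3 coefficient corollary (D) (HOME/STATUS 2026-08-29T07:47:38Z: for the twisted vehicle `V` and the cusp matrix
`ω₀ = (a b; M D) ∈ SL₂(ℤ)`, every `HasSum` coefficient function `g` of `V ∣_k ω₀` in the parameter `𝕢_H` has
`g(u·H₁) = q^(−2k−2) · c₀(qu) · S(qu)`), seat w6 g9's T1 (`S(qu) = (q/2)·(1 + σ·q·J(−u|q))`, an INTEGER multiple of `q/2`, the integer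
being prime to `p` on the opposite Legendre class when `q* ≢ 1 (mod p)`) and seat w8 g9's T5 target (Rung⁶) (currency
`‖(H(k,a) : ℚ_p)‖ ≤ p⁻¹`):
* §7a `hasSum_qExpansion_slash_of_gamma1` — `(V ∣_k γ)(w) = Σ_K coeff K (qExpansion N (V ∣_k γ)) · 𝕢_N(w)^K` (the `g` of (D) at `H = N`),
  `analyticAt_cuspFunction_slash_of_gamma1`, `eq_qExpansion_slash_coeff_of_hasSum` (any `HasSum` coefficient function IS `qExpansion N`);
* §7b units of `ℤ̄[1/N]`: `1/q`, `q^e` (`e : ℤ`) for `q ∣ N`;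
* §7c **`norm_ratCast_le_inv_of_coeff_eq_unit_mul`** (normalisation-free: coefficient `= u·x·c`, `u` a unit of `ℤ̄[1/N]`) and
  **`norm_ratCast_le_inv_of_coeff_eq`** (T3's normalisation `q^(−2k−2)·x·S`, `S = (q/2)·c`): `‖x‖_p ≤ p⁻¹`.
CONDITIONAL on the cite-only named fact NF-Q `Katz1973_qExpansionPrinciple_allCusps` (hypothesis), nothing else. No new definitions, no
named facts, no `sorry`. beyond-print theorem: NO. BSD is not proved by any of this; no summit statement is proved by this seat.

References: [Katz1973] §1.6 Cor. 1.6.2; [DiamondShurman2005] §1.1–1.2; crux notes `Lines/eisenstein-resource-bdp-line-lead-g14.md` §2.1.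
-/

-- summit-side namespace `Summit.BirchSwinnertonDyer.BirchSwinnertonDyer.…` (single-conjunct summit, D-0017 layout)
set_option linter.dupNamespace false

noncomputable section

namespace Summit.BirchSwinnertonDyer.BirchSwinnertonDyer.Theorems.PrintCFram.FlipRung

open UpperHalfPlane Filter Function Complex CongruenceSubgroup PowerSeries
open scoped MatrixGroups ModularForm Topology Manifold Real
open Summit.BirchSwinnertonDyer.BirchSwinnertonDyer.Theorems.PrintCFram.CuspGlue

/-! ## §7 THE READING SOCKET: `HasSum` of the expansion at the cusp, units of `ℤ̄[1/N]`, and «coefficient = unit · x · c ⟹ ‖x‖_p ≤ p⁻¹» -/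

/-- **The `𝕢_N`-expansion of `V ∣_k γ` as a convergent series** (the coefficient function `g` that T3's coefficient corollary (D)
quantifies over, at the period `H = N`): for `V : ModularForm (Gamma1 L) k`, `L ∣ N`, `N ≥ 1`, `γ ∈ SL₂(ℤ)` and `w ∈ ℍ`,
`(V ∣_k γ)(w) = Σ_K coeff K (qExpansion N (V ∣_k γ)) · 𝕢_N(w)^K` (`V ∣_k γ` is a modular form on `Γ(N)`; Mathlib `hasSum_qExpansion`).
[cite: DiamondShurman2005, §1.2] -/
theorem hasSum_qExpansion_slash_of_gamma1 {L N : ℕ} [NeZero N] (hLN : L ∣ N) {k : ℤ} (V : ModularForm (Gamma1 L) k)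
    (γ : SL(2, ℤ)) (w : ℍ) :
    HasSum (fun K : ℕ => (qExpansion N (⇑V ∣[k] γ)).coeff K • Periodic.qParam N w ^ K) ((⇑V ∣[k] γ) w) := by
  haveI : NeZero L := ⟨by rintro rfl; rw [zero_dvd_iff] at hLN; exact NeZero.ne N hLN⟩
  obtain ⟨g, hg⟩ := exists_modularForm_gamma_coe_eq_of_gamma1 V hLN
  obtain ⟨g', hg'⟩ := exists_modularForm_gamma_coe_eq_slash g γ
  have hN : (0 : ℝ) < N := by exact_mod_cast Nat.pos_of_ne_zero (NeZero.ne N)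
  have hΓ : (N : ℝ) ∈ (Gamma N : Subgroup (GL (Fin 2) ℝ)).strictPeriods := by
    rw [strictPeriods_Gamma]; exact AddSubgroup.mem_zmultiples _
  have h := UpperHalfPlane.hasSum_qExpansion hN (SlashInvariantFormClass.periodic_comp_ofComplex g' hΓ) g'.holo'
    (ModularFormClass.bdd_at_infty g') w
  rw [hg', hg] at h
  exact h

/-- `V ∣_k γ` is `N`-periodic, holomorphic and bounded at `i∞` (for `V` on `Γ₁(L)`, `L ∣ N`, `N ≥ 1`, `γ ∈ SL₂(ℤ)`), hence its cusp
function in the parameter `e^{2πiz/N}` is analytic at `0` — the uniqueness currency for identifying coefficients of `qExpansion N (V ∣_k γ)`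
from ANY `HasSum` representation ((γ) `qExpansion_coeff_unique_of_hasSum`). [cite: DiamondShurman2005, §1.2] -/
theorem analyticAt_cuspFunction_slash_of_gamma1 {L N : ℕ} [NeZero N] (hLN : L ∣ N) {k : ℤ} (V : ModularForm (Gamma1 L) k)
    (γ : SL(2, ℤ)) :
    Periodic ((⇑V ∣[k] γ) ∘ ofComplex) (N : ℝ) ∧ MDifferentiable 𝓘(ℂ) 𝓘(ℂ) (⇑V ∣[k] γ) ∧ IsBoundedAtImInfty (⇑V ∣[k] γ) ∧
      AnalyticAt ℂ (cuspFunction N (⇑V ∣[k] γ)) 0 := by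
  haveI : NeZero L := ⟨by rintro rfl; rw [zero_dvd_iff] at hLN; exact NeZero.ne N hLN⟩
  obtain ⟨g, hg⟩ := exists_modularForm_gamma_coe_eq_of_gamma1 V hLN
  obtain ⟨g', hg'⟩ := exists_modularForm_gamma_coe_eq_slash g γ
  have hN : (0 : ℝ) < N := by exact_mod_cast Nat.pos_of_ne_zero (NeZero.ne N)
  have hΓ : (N : ℝ) ∈ (Gamma N : Subgroup (GL (Fin 2) ℝ)).strictPeriods := by
    rw [strictPeriods_Gamma]; exact AddSubgroup.mem_zmultiples _
  have hper := SlashInvariantFormClass.periodic_comp_ofComplex g' hΓ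
  have hbdd := ModularFormClass.bdd_at_infty g'
  rw [hg', hg] at hper hbdd
  have hhol : MDifferentiable 𝓘(ℂ) 𝓘(ℂ) (⇑V ∣[k] γ) := by
    have h := (ModularFormClass.holo g' : MDifferentiable 𝓘(ℂ) 𝓘(ℂ) ⇑g'); rwa [hg', hg] at h
  exact ⟨hper, hhol, hbdd, analyticAt_cuspFunction_zero hN hper hhol hbdd⟩

/-- **Coefficients from any `HasSum` representation**: if `(V ∣_k γ)(w) = Σ_K g K · 𝕢_N(w)^K` for every `w`, then `g` IS the coefficient
function of `qExpansion N (V ∣_k γ)` (uniqueness of q-expansions; so T3's (D), stated for an arbitrary `HasSum` coefficient function, applies to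
`qExpansion N`). [cite: DiamondShurman2005, §1.1] -/
theorem eq_qExpansion_slash_coeff_of_hasSum {L N : ℕ} [NeZero N] (hLN : L ∣ N) {k : ℤ} (V : ModularForm (Gamma1 L) k)
    (γ : SL(2, ℤ)) {g : ℕ → ℂ} (hg : ∀ w : ℍ, HasSum (fun K : ℕ => g K • Periodic.qParam N w ^ K) ((⇑V ∣[k] γ) w)) (K : ℕ) :
    g K = (qExpansion N (⇑V ∣[k] γ)).coeff K :=
  qExpansion_coeff_unique_of_hasSum (by exact_mod_cast Nat.pos_of_ne_zero (NeZero.ne N))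
    (analyticAt_cuspFunction_slash_of_gamma1 hLN V γ).2.2.2 hg K

/-- `1/q ∈ ℤ̄[1/N]` for `q ∣ N`, `q ≠ 0`. [folklore] -/
theorem exists_isIntegral_pow_mul_inv_of_dvd {q N : ℕ} (hq : q ≠ 0) (hqN : q ∣ N) :
    ∃ j : ℕ, IsIntegral ℤ ((N : ℂ) ^ j * (q : ℂ)⁻¹) := by
  obtain ⟨c, rfl⟩ := hqN
  refine ⟨1, ?_⟩
  have : ((q * c : ℕ) : ℂ) ^ 1 * (q : ℂ)⁻¹ = (c : ℂ) := by
    push_cast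
    rw [pow_one, mul_comm (q : ℂ) c, mul_assoc, mul_inv_cancel₀ (by exact_mod_cast hq), mul_one]
  rw [this]
  exact isIntegral_natCast c

/-- `q^e ∈ ℤ̄[1/N]` for every `e : ℤ` when `q ∣ N`, `q ≠ 0` (the normalisations `q^(−2k−2)` of T3 are units of `ℤ̄[1/N]`). [folklore] -/
theorem exists_isIntegral_pow_mul_zpow_of_dvd {q N : ℕ} (hq : q ≠ 0) (hqN : q ∣ N) (e : ℤ) :
    ∃ j : ℕ, IsIntegral ℤ ((N : ℂ) ^ j * (q : ℂ) ^ e) := by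
  cases e with
  | ofNat n =>
    refine ⟨0, ?_⟩
    rw [Int.ofNat_eq_natCast, zpow_natCast, pow_zero, one_mul]
    exact (isIntegral_natCast q).pow n
  | negSucc n =>
    obtain ⟨j, hj⟩ := exists_isIntegral_pow_mul_inv_of_dvd hq hqN
    refine ⟨j * (n + 1), ?_⟩
    rw [zpow_negSucc, pow_mul, ← inv_pow, ← mul_pow]
    exact hj.pow _

/-- **THE READING, normalisation-free form.** NF-Q, `V : ModularForm (Gamma1 L) k`, `L ∣ N`, `3 ≤ N`, `p ∤ N` prime, every coefficient of
`qExpansion 1 V` in `p·ℤ̄[1/N]`, `γ ∈ SL₂(ℤ)`. If SOME coefficient of `qExpansion N (V ∣_k γ)` equals `u · x · c` with `x : ℚ` (a Cohen-type number),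
`c : ℤ` prime to `p` (T1's weight `1 ± q*` on the opposite Legendre class) and `u` a unit of `ℤ̄[1/N]` (inverse `v ∈ ℤ̄[1/N]`), then
`‖x‖_p ≤ p⁻¹` — the currency of T5's (Rung⁶) («`‖(H(k,a) : ℚ_p)‖ ≤ p⁻¹`»). CONDITIONAL on NF-Q (hypothesis). [cite: Katz1973, §1.6 Cor. 1.6.2] -/
theorem norm_ratCast_le_inv_of_coeff_eq_unit_mul
    (hKatz : Literature.NumberTheory.ModularForms.Katz1973_qExpansionPrinciple_allCusps)
    {L N : ℕ} (hLN : L ∣ N) (hN : 3 ≤ N) {k : ℤ} (V : ModularForm (Gamma1 L) k) {p : ℕ} [hp : Fact p.Prime] (hpN : ¬ p ∣ N)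
    (hcoef : ∀ n : ℕ, ∃ y : ℂ, (∃ j : ℕ, IsIntegral ℤ ((N : ℂ) ^ j * y)) ∧ (qExpansion 1 ⇑V).coeff n = (p : ℂ) * y)
    (γ : SL(2, ℤ)) {K : ℕ} {x : ℚ} {c : ℤ} (hc : ¬ (p : ℤ) ∣ c) {u v : ℂ} (huv : u * v = 1)
    (hv : ∃ j : ℕ, IsIntegral ℤ ((N : ℂ) ^ j * v)) (hD : (qExpansion N (⇑V ∣[k] γ)).coeff K = u * (x : ℂ) * (c : ℂ)) :
    ‖((x : ℚ) : ℚ_[p])‖ ≤ (p : ℝ)⁻¹ := by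
  obtain ⟨y, hy, hK⟩ := exists_isIntegral_qExpansion_slash_coeff hKatz hLN hN V p hcoef γ K
  have hx : (x : ℂ) * (c : ℂ) * u = (p : ℂ) ^ 1 * y := by rw [pow_one, ← hK, hD]; ring
  have h := le_padicValRat_of_mul_mul_eq_pow_mul hpN hc huv hv hy hx
  have hlt : ‖((x : ℚ) : ℚ_[p])‖ < 1 := padicNorm_lt_one_of_padicValRat (by simpa using h)
  have := (Padic.norm_le_pow_iff_norm_lt_pow_add_one ((x : ℚ) : ℚ_[p]) (-1)).mpr (by simpa using hlt)
  simpa using this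

/-- **THE READING with T3's normalisation** (w4 g19 07:47:38Z (D): `g (u·H₁) = q^(−2k−2) · c₀(qu) · S(qu)`; T1: `S(qu) = (q/2)·(1 + σ q J(−u|q))`):
NF-Q, `V : ModularForm (Gamma1 L) k`, `L ∣ N`, `3 ≤ N`, `p ∤ N`, `q ∣ N` (`q ≠ 0`), every coefficient of `qExpansion 1 V` in `p·ℤ̄[1/N]`,
`ω₀ ∈ SL₂(ℤ)`; if `coeff K (qExpansion N (V ∣_k ω₀)) = q^(−2k−2) · x · S` with `S = (q/2)·c`, `c : ℤ` prime to `p`, `x : ℚ`, then `‖x‖_p ≤ p⁻¹`.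
CONDITIONAL on NF-Q (hypothesis). [cite: Katz1973, §1.6 Cor. 1.6.2] -/
theorem norm_ratCast_le_inv_of_coeff_eq
    (hKatz : Literature.NumberTheory.ModularForms.Katz1973_qExpansionPrinciple_allCusps)
    {L N : ℕ} (hLN : L ∣ N) (hN : 3 ≤ N) {k : ℤ} (V : ModularForm (Gamma1 L) k) {p : ℕ} [hp : Fact p.Prime] (hpN : ¬ p ∣ N)
    (hcoef : ∀ n : ℕ, ∃ y : ℂ, (∃ j : ℕ, IsIntegral ℤ ((N : ℂ) ^ j * y)) ∧ (qExpansion 1 ⇑V).coeff n = (p : ℂ) * y)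
    (ω₀ : SL(2, ℤ)) {q : ℕ} (hq : q ≠ 0) (hqN : q ∣ N) {K : ℕ} {x : ℚ} {S : ℂ} {c : ℤ} (hc : ¬ (p : ℤ) ∣ c)
    (hD : (qExpansion N (⇑V ∣[k] ω₀)).coeff K = (q : ℂ) ^ (-(2 * k) - 2) * (x : ℂ) * S) (hS : S = (q : ℂ) / 2 * (c : ℂ)) :
    ‖((x : ℚ) : ℚ_[p])‖ ≤ (p : ℝ)⁻¹ := by
  have hq' : (q : ℂ) ≠ 0 := by exact_mod_cast hq
  refine norm_ratCast_le_inv_of_coeff_eq_unit_mul hKatz hLN hN V hpN hcoef ω₀ (K := K) hc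
    (u := (q : ℂ) ^ (-(2 * k) - 2) * ((q : ℂ) / 2)) (v := (q : ℂ) ^ (2 * k + 2) * (2 * (q : ℂ)⁻¹)) ?_ ?_ ?_
  · have h1 : (q : ℂ) ^ (-(2 * k) - 2) * (q : ℂ) ^ (2 * k + 2) = 1 := by
      rw [← zpow_add₀ hq']; ring_nf; simp
    calc (q : ℂ) ^ (-(2 * k) - 2) * ((q : ℂ) / 2) * ((q : ℂ) ^ (2 * k + 2) * (2 * (q : ℂ)⁻¹))
        = ((q : ℂ) ^ (-(2 * k) - 2) * (q : ℂ) ^ (2 * k + 2)) * ((q : ℂ) * (q : ℂ)⁻¹) * (2 / 2) := by ring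
      _ = 1 := by rw [h1, mul_inv_cancel₀ hq']; norm_num
  · exact exists_isIntegral_pow_mul_mul (exists_isIntegral_pow_mul_zpow_of_dvd hq hqN _)
      (exists_isIntegral_pow_mul_mul (exists_isIntegral_pow_mul_natCast 2) (exists_isIntegral_pow_mul_inv_of_dvd hq hqN))
  · rw [hD, hS]; ring

end Summit.BirchSwinnertonDyer.BirchSwinnertonDyer.Theorems.PrintCFram.FlipRung

end
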